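import Summits.MatrixMultiplication.MatrixMultiplication.Theses.CommutativeSchemes

/-!
# MatrixMultiplication / CommutativeSchemes — `ThickTopLemma` (stmt-MatrixMultiplication-9467)

Route `CommutativeSchemes`, support item `ThickTopLemma`: the abstract thick-top lemma of the card
thick-top-schemes-no-go.

Setting: classes `Fin r` with a triangle relation `Tri`, heights `h : Fin r → ℕ`, types
`par : Fin r → Fin q` and a compatibility predicate `Comp`; hypotheses
(i) `Tri i j k → h i ≤ h j + h k` (triangle inequality on heights),
(ii) `Tri i j k → Comp i (par j) (par k)`,
(iii) thickness: `h j ≤ h i`, `h k ≤ h i`, `h i ≤ h j + h k` and `Comp i (par j) (par k)` force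
`Tri i j k`;
a realisation `α, β, γ : Fin n × Fin n → Fin r` of `⟨n,n,n⟩` over `Tri`, and a class
`M = α (i₀, j₀)` dominating the heights of the row `β (j₀, ·)` and the column `γ (·, i₀)`.
Conclusion: `n ≤ q`.

Proof (as on the route card, 2026-08-15): put `b k = β (j₀, k)`, `c k = γ (k, i₀)`; the
realisation gives `Tri M (b k') (c k) ↔ k = k'`. If `par (b k) = par (b k')` with `k ≠ k'`, then
(ii) on the two diagonal triangles gives `Comp M (par (b k')) (par (c k))` and
`Comp M (par (b k)) (par (c k'))`, so by (iii) (contrapositive, the off-diagonal triangles being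
absent) `h (b k') + h (c k) < h M` and `h (b k) + h (c k') < h M`, while (i) on the diagonal
triangles gives `h M ≤ h (b k) + h (c k)` and `h M ≤ h (b k') + h (c k')`; summing is absurd. Hence
`k ↦ par (b k) : Fin n → Fin q` is injective and `n ≤ q`.

Sources: arXiv:1207.6528 (Cohn–Umans 2013, the realisation notion, Def. 11/12);
Brouwer–Cohen–Neumaier doi:10.1007/978-3-642-74341-2 (metric schemes, where the lemma is applied
via `HammingNoGo` / `MetricNoGain`). The lemma itself is elementary order bookkeeping.
-/

-- the tree's namespace `Summit.MatrixMultiplication.MatrixMultiplication.…` repeats a component by design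
set_option linter.dupNamespace false

namespace Summit.MatrixMultiplication.MatrixMultiplication.Theorems

open Summit.MatrixMultiplication.MatrixMultiplication.Theses.CommutativeSchemes

/-- **Thick-top lemma** (route CommutativeSchemes, stmt-MatrixMultiplication-9467): under the
triangle inequality (i), type compatibility (ii) and thickness (iii), a realisation `α, β, γ` of
`⟨n,n,n⟩` over `Tri` with a height-dominating class `α (i₀, j₀)` has `n ≤ q` — the map
`k ↦ par (β (j₀, k))` is injective. -/
theorem thickTopLemma_proof :
    Summit.MatrixMultiplication.MatrixMultiplication.Theses.CommutativeSchemes.ThickTopLemma := by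
  unfold ThickTopLemma
  intro r n q Tri h par Comp α β γ htri hcomp hthick hreal hdom
  obtain ⟨i₀, j₀, hdom⟩ := hdom
  -- diagonal triangles exist, off-diagonal ones do not
  have hdiag : ∀ m : Fin n, Tri (α (i₀, j₀)) (β (j₀, m)) (γ (m, i₀)) := fun m =>
    (hreal i₀ i₀ j₀ j₀ m m).2 ⟨rfl, rfl, rfl⟩
  have hoff : ∀ m m' : Fin n, Tri (α (i₀, j₀)) (β (j₀, m')) (γ (m, i₀)) → m = m' :=
    fun m m' ht => ((hreal i₀ i₀ j₀ j₀ m m').1 ht).2.2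
  -- the type of the row class determines the column index
  have key : Function.Injective (fun k : Fin n => par (β (j₀, k))) := by
    intro k k' hkk
    by_contra hne
    simp only at hkk
    have h1 : h (α (i₀, j₀)) ≤ h (β (j₀, k)) + h (γ (k, i₀)) := htri _ _ _ (hdiag k)
    have h2 : h (α (i₀, j₀)) ≤ h (β (j₀, k')) + h (γ (k', i₀)) := htri _ _ _ (hdiag k')
    have c1 : Comp (α (i₀, j₀)) (par (β (j₀, k))) (par (γ (k, i₀))) := hcomp _ _ _ (hdiag k)
    have c2 : Comp (α (i₀, j₀)) (par (β (j₀, k'))) (par (γ (k', i₀))) := hcomp _ _ _ (hdiag k')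
    have n1 : ¬ h (α (i₀, j₀)) ≤ h (β (j₀, k')) + h (γ (k, i₀)) := by
      intro hle
      refine hne (hoff k k' (hthick _ _ _ (hdom k').1 (hdom k).2 hle ?_))
      rw [← hkk]
      exact c1
    have n2 : ¬ h (α (i₀, j₀)) ≤ h (β (j₀, k)) + h (γ (k', i₀)) := by
      intro hle
      refine hne (hoff k' k (hthick _ _ _ (hdom k).1 (hdom k').2 hle ?_)).symm
      rw [hkk]
      exact c2
    omega
  simpa using Fintype.card_le_of_injective _ key

end Summit.MatrixMultiplication.MatrixMultiplication.Theorems
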